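import Literature.NumberTheory.EllipticCurves.PAdicLFunctionTame
import Literature.NumberTheory.EllipticCurves.PAdicLFunctionDistributionHoldsProofs
import HarnessLib

/-!
# The tame-level Mazur–Swinnerton-Dyer measure: Matsuno 2000 Lemma 2.2 (change of tame level) IN THE KERNEL
# — discharge of the named fact `msdMeasureTame_levelChange` (PROOFS ONLY: no `def`, no named fact)

Companion of `Literature.NumberTheory.EllipticCurves.PAdicLFunctionTame` (definitions `tameRep`, `tameFraction`,
`msdMeasureTame`, …; cell bsd-2adic, seat conv-1, planner RULING RC-159). This file PROVES, from the tree's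
Hecke relation for rational plus symbols at a good prime (`intCast_mul_ratPlusSymbol`, Mazur–Tate–Teitelbaum
(4.2)) and their `ℤ`-periodicity (`ratPlusSymbol_add_intCast_eq`):

* §1 `natCast_tameRep_left/right` — the Chinese-remainder representative `c = tameRep p m n a b` reduces to
  `a mod pⁿ` and `b mod m` (`(m, p) = 1`); `intCast_dvd_sub_of_natCast_eq` (CRT uniqueness);
  `ratPlusSymbol_mul_div_eq_of_dvd_sub` (`[k c/M]⁺` depends on `c mod M` only).
* §2 `sum_ratPlusSymbol_tameFraction_lift` — THE CORE IDENTITY (Matsuno's proof of Lemma 2.2, p. 85):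
  for `k` prime to `ℓ`, `∑_{u<ℓ} [k·c'_u/(pⁿmℓ)]⁺ = a_ℓ·[k·c/(pⁿm)]⁺ − [k·(ℓc)/(pⁿm)]⁺`, where `c'_u` is the CRT
  representative of `(a, c + pⁿmu)` at level `mℓ`: the `ℓ` lifted fractions are `(x + ku)/ℓ`, `x = kc/(pⁿm)`,
  `u ↦ ku mod ℓ` permutes `ℤ/ℓ`, and the Hecke relation at `ℓ` gives `∑_j [(x+j)/ℓ]⁺ = a_ℓ[x]⁺ − [ℓx]⁺`.
* §3 `sum_msdMeasureTame_lift` — the measure identity over the explicit lifts (`k = 1` and `k = p`);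
  §4 `filter_castHom_eq_image_lift` (the fibre of `ℤ/mℓ → ℤ/m` over `b` IS the set of lifts, CRT) and
  **`sum_filter_msdMeasureTame`**, **`msdMeasureTame_levelChange_holds`** — the named fact, discharged
  (rationality `hrat` from `ratCast_ratPlusSymbol_holds`, Manin–Drinfeld).

References: K. Matsuno, J. Number Theory 84 (2000), Lemma 2.2 (p. 85) [Matsuno2000]; B. Mazur,
P. Swinnerton-Dyer, Invent. Math. 25 (1974), §8 Lemma 2 [MazurSwinnertonDyer1974Invent]; B. Mazur, J. Tate,
J. Teitelbaum, Invent. Math. 84 (1986), §I.4 (4.2), §I.10 [MazurTateTeitelbaum1986Invent].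
-/

noncomputable section

open scoped MatrixGroups ModularForm

open CongruenceSubgroup Filter Topology Literature.NumberTheory.EllipticCurves.ModularForms

namespace Literature.NumberTheory.EllipticCurves

/-! ## Arithmetic of the CRT representative -/

section CRT

variable {p m n : ℕ}

/-- The Chinese-remainder representative reduces to `a` mod `pⁿ` (`(m, p) = 1`: `m` is a unit mod `pⁿ`).
[cite: MazurTateTeitelbaum1986Invent, §I.10 (pp. 12–13)] -/
theorem natCast_tameRep_left [NeZero m] (hp : p.Prime) (hmp : m.Coprime p) (a : ZMod (p ^ n))
    (b : ZMod m) : ((tameRep p m n a b : ℕ) : ZMod (p ^ n)) = a := by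
  haveI : NeZero (p ^ n) := ⟨pow_ne_zero _ hp.ne_zero⟩
  have hu : IsUnit (m : ZMod (p ^ n)) := by
    rw [ZMod.isUnit_iff_coprime]
    exact hmp.pow_right n
  rw [tameRep, Nat.cast_add, Nat.cast_mul, Nat.cast_mul, ZMod.natCast_zmod_val, ZMod.natCast_self, mul_zero,
    add_zero, mul_assoc, ZMod.inv_mul_of_unit _ hu, mul_one]

/-- The Chinese-remainder representative reduces to `b` mod `m` (`(m, p) = 1`: `pⁿ` is a unit mod `m`).
[cite: MazurTateTeitelbaum1986Invent, §I.10 (pp. 12–13)] -/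
theorem natCast_tameRep_right [NeZero m] (hmp : m.Coprime p) (a : ZMod (p ^ n))
    (b : ZMod m) : ((tameRep p m n a b : ℕ) : ZMod m) = b := by
  have hu : IsUnit ((p : ZMod m) ^ n) := by
    refine IsUnit.pow n ?_
    rw [ZMod.isUnit_iff_coprime]
    exact hmp.symm
  rw [tameRep, Nat.cast_add, Nat.cast_mul, Nat.cast_mul, ZMod.natCast_self, mul_zero, zero_add,
    ZMod.natCast_zmod_val, Nat.cast_pow, mul_assoc, ZMod.inv_mul_of_unit _ hu, mul_one]

/-- Two naturals with the same residues mod `pⁿ` and mod `m` (coprime) agree mod `pⁿm`. [folklore] -/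
private theorem intCast_dvd_sub_of_natCast_eq (hmp : m.Coprime p) {c c' : ℕ}
    (h1 : (c : ZMod (p ^ n)) = c') (h2 : (c : ZMod m) = c') :
    ((p ^ n * m : ℕ) : ℤ) ∣ (c : ℤ) - c' := by
  have h1' : c ≡ c' [MOD p ^ n] := (ZMod.natCast_eq_natCast_iff _ _ _).mp h1
  have h2' : c ≡ c' [MOD m] := (ZMod.natCast_eq_natCast_iff _ _ _).mp h2
  have h : c ≡ c' [MOD p ^ n * m] :=
    (Nat.modEq_and_modEq_iff_modEq_mul (hmp.symm.pow_left n)).mp ⟨h1', h2'⟩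
  exact Nat.modEq_iff_dvd.mp h.symm

/-- `[r]⁺_f` only depends on `r mod ℤ` (Mazur–Tate–Teitelbaum §I.4 (4.2), tree `ratPlusSymbol_add_intCast_eq`):
`M ∣ c − c'` gives `[k c/M]⁺ = [k c'/M]⁺`. [cite: MazurTateTeitelbaum1986Invent, §I.4 (4.2)] -/
theorem ratPlusSymbol_mul_div_eq_of_dvd_sub {N : ℕ} [NeZero N] (f : CuspForm (Gamma0 N) 2) {M : ℕ}
    (hM : M ≠ 0) {c c' : ℤ} (h : (M : ℤ) ∣ c - c') (k : ℕ) :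
    ratPlusSymbol f ((k : ℚ) * ((c : ℚ) / M)) = ratPlusSymbol f ((k : ℚ) * ((c' : ℚ) / M)) := by
  obtain ⟨e, he⟩ := h
  have hM' : (M : ℚ) ≠ 0 := by exact_mod_cast hM
  have : (k : ℚ) * ((c : ℚ) / M) = (k : ℚ) * ((c' : ℚ) / M) + (((k : ℤ) * e : ℤ) : ℚ) := by
    have hc : (c : ℚ) = c' + M * e := by exact_mod_cast (sub_eq_iff_eq_add'.mp he)
    rw [hc]
    push_cast
    field_simp
  rw [this, ratPlusSymbol_add_intCast_eq]

end CRT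

/-! ## The reindexing lemma: lifting the `ℓ` classes over `b`, and the Hecke relation at `ℓ` -/

section Lift

variable {N : ℕ} [NeZero N] {f : CuspForm (Gamma0 N) 2} {p m ℓ n : ℕ}

/-- `u ↦ k·u mod ℓ` is a bijection of `Fin ℓ` for `k` coprime to `ℓ`. [folklore] -/
private theorem bijective_mul_mod (hℓ : 0 < ℓ) {k : ℕ} (hk : k.Coprime ℓ) :
    Function.Bijective (fun u : Fin ℓ => (⟨k * u % ℓ, Nat.mod_lt _ hℓ⟩ : Fin ℓ)) := by
  refine (Finite.injective_iff_bijective).mp fun u u' h => ?_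
  have h' : k * u % ℓ = k * u' % ℓ := by simpa using congrArg Fin.val h
  have hmod : (u : ℕ) ≡ u' [MOD ℓ] :=
    Nat.ModEq.cancel_left_of_coprime (by simpa [Nat.coprime_comm] using hk) h'
  exact Fin.ext (by
    have := hmod
    rw [Nat.ModEq, Nat.mod_eq_of_lt u.isLt, Nat.mod_eq_of_lt u'.isLt] at this
    exact this)

/-- **Core identity** (Matsuno 2000, proof of Lemma 2.2): with `c` the CRT representative of `(a, b)` at
level `m`, the `ℓ` classes `b'_u = c + pⁿ m u (mod mℓ)` lie over `b`, and for `k` coprime to `ℓ`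
`∑_u [k·c'_u/(pⁿmℓ)]⁺ = a_ℓ·[k·c/(pⁿm)]⁺ − [k·(ℓc)/(pⁿm)]⁺` — the Hecke relation at `ℓ` read at
`x = k c/(pⁿ m)`. [cite: Matsuno2000, Lemma 2.2 (p. 85), proof] [cite: MazurTateTeitelbaum1986Invent, §I.4 (4.2)] -/
theorem sum_ratPlusSymbol_tameFraction_lift [NeZero m] [NeZero (m * ℓ)] (hp : p.Prime) (hf : IsNewform0 f)
    (hrat : ∀ r : ℚ, (ratPlusSymbol f r : ℝ) = normalizedPlusSymbol f r) (hℓ : ℓ.Prime) (hℓN : ¬ ℓ ∣ N)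
    {aℓ : ℤ} (haℓ : cuspCoeff f ℓ = aℓ) (hmp : m.Coprime p) (hℓp : ℓ.Coprime p)
    (a : ZMod (p ^ n)) (b : ZMod m) {k : ℕ} (hk : k.Coprime ℓ) :
    ∑ u : Fin ℓ, ratPlusSymbol f ((k : ℚ) *
        tameFraction p (m * ℓ) n a ((tameRep p m n a b + p ^ n * m * (u : ℕ) : ℕ) : ZMod (m * ℓ))) =
      (aℓ : ℚ) * ratPlusSymbol f ((k : ℚ) * tameFraction p m n a b) -
        ratPlusSymbol f ((k : ℚ) * tameFraction p m n (a * (ℓ : ZMod (p ^ n))) (b * (ℓ : ZMod m))) := by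
  have hmℓp : (m * ℓ).Coprime p := Nat.Coprime.mul_left hmp hℓp
  haveI : NeZero ℓ := ⟨hℓ.ne_zero⟩
  have hM1 : p ^ n * (m * ℓ) ≠ 0 := mul_ne_zero (pow_ne_zero _ hp.ne_zero) (mul_ne_zero (NeZero.ne m) hℓ.ne_zero)
  have hM2 : p ^ n * m ≠ 0 := mul_ne_zero (pow_ne_zero _ hp.ne_zero) (NeZero.ne m)
  have hp0 : (p : ℚ) ^ n ≠ 0 := pow_ne_zero _ (by exact_mod_cast hp.ne_zero)
  have hm0 : (m : ℚ) ≠ 0 := by exact_mod_cast (NeZero.ne m)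
  have hℓ0 : (ℓ : ℚ) ≠ 0 := by exact_mod_cast hℓ.ne_zero
  set c := tameRep p m n a b with hc
  set x : ℚ := (k : ℚ) * tameFraction p m n a b with hx
  -- (S1)+(S2)+(S3): each lifted symbol is `[(x + (k u mod ℓ))/ℓ]⁺`
  have hterm : ∀ u : Fin ℓ, ratPlusSymbol f ((k : ℚ) *
      tameFraction p (m * ℓ) n a ((c + p ^ n * m * (u : ℕ) : ℕ) : ZMod (m * ℓ))) =
      ratPlusSymbol f ((x + ((k * u % ℓ : ℕ) : ℚ)) / ℓ) := by
    intro u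
    set b' : ZMod (m * ℓ) := ((c + p ^ n * m * (u : ℕ) : ℕ) : ZMod (m * ℓ)) with hb'
    set c' := tameRep p (m * ℓ) n a b' with hc'
    -- residues of `c'` and of `c + pⁿ m u`
    have h1 : (c' : ZMod (p ^ n)) = ((c + p ^ n * m * (u : ℕ) : ℕ) : ZMod (p ^ n)) := by
      rw [hc', natCast_tameRep_left hp hmℓp, Nat.cast_add, hc, natCast_tameRep_left hp hmp]
      haveI : NeZero (p ^ n) := ⟨pow_ne_zero _ hp.ne_zero⟩
      rw [Nat.cast_mul, Nat.cast_mul, ZMod.natCast_self, zero_mul, zero_mul, add_zero]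
    have h2 : (c' : ZMod (m * ℓ)) = ((c + p ^ n * m * (u : ℕ) : ℕ) : ZMod (m * ℓ)) := by
      rw [hc', natCast_tameRep_right hmℓp]
    have hdvd := intCast_dvd_sub_of_natCast_eq (n := n) hmℓp h1 h2
    have hfrac : tameFraction p (m * ℓ) n a b' = ((c' : ℤ) : ℚ) / ((p ^ n * (m * ℓ) : ℕ) : ℚ) := by
      rw [tameFraction, ← hc']
      push_cast
      ring
    rw [hfrac, ratPlusSymbol_mul_div_eq_of_dvd_sub f hM1 hdvd k]
    -- (S2): `k (c + pⁿ m u)/(pⁿ m ℓ) = (x + k u)/ℓ`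
    have hS2 : (k : ℚ) * ((((c + p ^ n * m * (u : ℕ) : ℕ) : ℤ) : ℚ) / ((p ^ n * (m * ℓ) : ℕ) : ℚ)) =
        (x + ((k * u : ℕ) : ℚ)) / ℓ := by
      rw [hx, tameFraction]
      push_cast
      field_simp
      ring
    -- (S3): replace `k u` by `k u mod ℓ`
    have hdm : (k * (u : ℕ) : ℕ) = k * u % ℓ + ℓ * (k * u / ℓ) := (Nat.mod_add_div (k * u) ℓ).symm
    generalize hq : k * (u : ℕ) / ℓ = q at hdm
    generalize hr : k * (u : ℕ) % ℓ = r at hdm ⊢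
    have hS3 : (x + ((k * u : ℕ) : ℚ)) / ℓ = (x + (r : ℚ)) / ℓ + ((q : ℕ) : ℤ) := by
      rw [hdm]
      push_cast
      field_simp
      ring
    rw [hS2, hS3, ratPlusSymbol_add_intCast_eq]
  simp_rw [hterm]
  -- (S4): reindex by `u ↦ k u mod ℓ`
  have hS4 : ∑ u : Fin ℓ, ratPlusSymbol f ((x + ((k * u % ℓ : ℕ) : ℚ)) / ℓ) =
      ∑ j : Fin ℓ, ratPlusSymbol f ((x + j) / ℓ) :=
    (bijective_mul_mod hℓ.pos hk).sum_comp (fun j : Fin ℓ => ratPlusSymbol f ((x + j) / ℓ))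
  rw [hS4]
  -- (S5): Hecke at `ℓ`
  have hHecke := intCast_mul_ratPlusSymbol ℓ hf hℓ hℓN haℓ hrat x
  -- (S6): `[ℓ x]⁺ = [k · tameFraction(ℓa, ℓb)]⁺`
  have h6 : ratPlusSymbol f ((ℓ : ℚ) * x) =
      ratPlusSymbol f ((k : ℚ) * tameFraction p m n (a * (ℓ : ZMod (p ^ n))) (b * (ℓ : ZMod m))) := by
    have h1 : ((tameRep p m n (a * (ℓ : ZMod (p ^ n))) (b * (ℓ : ZMod m)) : ℕ) : ZMod (p ^ n)) =
        ((ℓ * c : ℕ) : ZMod (p ^ n)) := by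
      rw [natCast_tameRep_left hp hmp, Nat.cast_mul, hc, natCast_tameRep_left hp hmp, mul_comm]
    have h2 : ((tameRep p m n (a * (ℓ : ZMod (p ^ n))) (b * (ℓ : ZMod m)) : ℕ) : ZMod m) =
        ((ℓ * c : ℕ) : ZMod m) := by
      rw [natCast_tameRep_right hmp, Nat.cast_mul, hc, natCast_tameRep_right hmp, mul_comm]
    have hdvd := intCast_dvd_sub_of_natCast_eq (n := n) hmp h1 h2
    have hlhs : (ℓ : ℚ) * x = (k : ℚ) * ((((ℓ * c : ℕ) : ℤ) : ℚ) / ((p ^ n * m : ℕ) : ℚ)) := by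
      rw [hx, tameFraction]
      push_cast
      ring
    have hrhs : (k : ℚ) * tameFraction p m n (a * (ℓ : ZMod (p ^ n))) (b * (ℓ : ZMod m)) =
        (k : ℚ) * ((((tameRep p m n (a * (ℓ : ZMod (p ^ n))) (b * (ℓ : ZMod m)) : ℕ) : ℤ) : ℚ) /
          ((p ^ n * m : ℕ) : ℚ)) := by
      rw [tameFraction]
      push_cast
      ring
    rw [hlhs, hrhs]
    exact (ratPlusSymbol_mul_div_eq_of_dvd_sub f hM2 hdvd k).symm
  rw [hHecke, h6]
  ring

end Lift

/-! ## Matsuno 2000, Lemma 2.2 (two-term form over all `ℓ` lifts) for `msdMeasureTame` -/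

section LevelChange

variable {N : ℕ} [NeZero N] (f : CuspForm (Gamma0 N) 2) {p : ℕ} [Fact p.Prime] {m ℓ n : ℕ}

/-- **Change of tame level** (Matsuno 2000 Lemma 2.2 / Mazur–Swinnerton-Dyer §8 Lemma 2, two-term form):
with `c` the CRT representative of `(a, b)` at level `m` and `b'_u = c + pⁿmu (mod mℓ)` the `ℓ` classes over `b`,
`∑_u μ_{f,α,mℓ}((a + pⁿℤ_p) × {b'_u}) = a_ℓ · μ_{f,α,m}((a + pⁿℤ_p) × {b}) − μ_{f,α,m}((ℓa + pⁿℤ_p) × {ℓb})`.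
[cite: Matsuno2000, Lemma 2.2 (p. 85)] [cite: MazurSwinnertonDyer1974Invent, §8 Lemma 2] -/
theorem sum_msdMeasureTame_lift [NeZero m] [NeZero (m * ℓ)] (hf : IsNewform0 f)
    (hrat : ∀ r : ℚ, (ratPlusSymbol f r : ℝ) = normalizedPlusSymbol f r) (hℓ : ℓ.Prime) (hℓN : ¬ ℓ ∣ N)
    {aℓ : ℤ} (haℓ : cuspCoeff f ℓ = aℓ) (hmp : m.Coprime p) (hℓp : ℓ.Coprime p)
    (α : ℚ_[p]) (a : ZMod (p ^ n)) (b : ZMod m) :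
    ∑ u : Fin ℓ, msdMeasureTame f (m * ℓ) α n a ((tameRep p m n a b + p ^ n * m * (u : ℕ) : ℕ) : ZMod (m * ℓ)) =
      (aℓ : ℚ_[p]) * msdMeasureTame f m α n a b -
        msdMeasureTame f m α n (a * (ℓ : ZMod (p ^ n))) (b * (ℓ : ZMod m)) := by
  have hp : p.Prime := Fact.out
  have h1 := sum_ratPlusSymbol_tameFraction_lift (n := n) hp hf hrat hℓ hℓN haℓ hmp hℓp a b
    (Nat.coprime_one_left ℓ)
  have hP := sum_ratPlusSymbol_tameFraction_lift (n := n) hp hf hrat hℓ hℓN haℓ hmp hℓp a b hℓp.symm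
  simp only [Nat.cast_one, one_mul] at h1
  have h1' := congrArg (fun q : ℚ => (q : ℚ_[p])) h1
  have hP' := congrArg (fun q : ℚ => (q : ℚ_[p])) hP
  simp only [Rat.cast_sum, Rat.cast_sub, Rat.cast_mul, Rat.cast_intCast] at h1' hP'
  simp only [msdMeasureTame, Finset.sum_sub_distrib, ← Finset.mul_sum, h1', hP']
  ring

end LevelChange

/-! ## The fibre of `ZMod (mℓ) → ZMod m` over `b` is the set of lifts `c + pⁿ m u`, `u < ℓ` -/

section Fiber

variable {p m ℓ n : ℕ}

/-- The lift map `u ↦ c + pⁿ m u (mod mℓ)` is injective on `Fin ℓ` for `ℓ` prime to `p` and to `m` (the `ℓ`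
classes of `ℤ/pⁿmℓ` over a class of `ℤ/pⁿm`). [cite: MazurTateTeitelbaum1986Invent, §I.10 (pp. 12–13)] -/
theorem lift_injective [NeZero m] (hℓp : ℓ.Coprime p) (hℓm : ℓ.Coprime m) (c : ℕ) :
    Function.Injective (fun u : Fin ℓ => ((c + p ^ n * m * (u : ℕ) : ℕ) : ZMod (m * ℓ))) := by
  intro u u' h
  have h' : ((c + p ^ n * m * (u : ℕ) : ℕ) : ZMod ℓ) = ((c + p ^ n * m * (u' : ℕ) : ℕ) : ZMod ℓ) := by
    have := congrArg (ZMod.castHom (dvd_mul_left ℓ m) (ZMod ℓ)) h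
    simpa only [map_natCast] using this
  have hmod : (c + p ^ n * m * (u : ℕ)) ≡ (c + p ^ n * m * (u' : ℕ)) [MOD ℓ] :=
    (ZMod.natCast_eq_natCast_iff _ _ _).mp h'
  have hmod' : p ^ n * m * (u : ℕ) ≡ p ^ n * m * (u' : ℕ) [MOD ℓ] := Nat.ModEq.add_left_cancel' c hmod
  have hcop : Nat.Coprime ℓ (p ^ n * m) := Nat.Coprime.mul_right (hℓp.pow_right n) hℓm
  have hu : (u : ℕ) ≡ u' [MOD ℓ] := Nat.ModEq.cancel_left_of_coprime (by simpa [Nat.coprime_comm] using hcop) hmod'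
  exact Fin.ext (by
    have := hu
    rw [Nat.ModEq, Nat.mod_eq_of_lt u.isLt, Nat.mod_eq_of_lt u'.isLt] at this
    exact this)

/-- The fibre of the reduction `ℤ/mℓ → ℤ/m` over `b` is the image of the lift map `u ↦ c + pⁿmu` from the
Chinese-remainder representative `c` of `(a, b)` (so the compact opens of `ℤ_{p,mℓ}` over `(a + pⁿℤ_p) × {b}` are the
`ℓ` sets `(a + pⁿℤ_p) × {c + pⁿmu}`). [cite: MazurTateTeitelbaum1986Invent, §I.10 (pp. 12–13)] -/
theorem filter_castHom_eq_image_lift [NeZero m] [NeZero (m * ℓ)] (hℓ : ℓ.Prime) (hℓp : ℓ.Coprime p)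
    (hℓm : ℓ.Coprime m) (hmp : m.Coprime p) (a : ZMod (p ^ n)) (b : ZMod m) :
    Finset.univ.filter (fun b' : ZMod (m * ℓ) => ZMod.castHom (dvd_mul_right m ℓ) (ZMod m) b' = b) =
      Finset.univ.image (fun u : Fin ℓ => ((tameRep p m n a b + p ^ n * m * (u : ℕ) : ℕ) : ZMod (m * ℓ))) := by
  classical
  haveI : NeZero ℓ := ⟨hℓ.ne_zero⟩
  haveI : Fact ℓ.Prime := ⟨hℓ⟩
  set c := tameRep p m n a b with hc
  have hcb : (c : ZMod m) = b := natCast_tameRep_right hmp a b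
  ext b'
  simp only [Finset.mem_filter, Finset.mem_univ, true_and, Finset.mem_image]
  constructor
  · intro hb'
    -- `u := ((b' - c) · (pⁿ m)⁻¹ mod ℓ).val`
    have hunit : IsUnit ((p ^ n * m : ℕ) : ZMod ℓ) := by
      rw [ZMod.isUnit_iff_coprime]
      exact Nat.Coprime.mul_left (hℓp.symm.pow_left n) hℓm.symm
    set t : ZMod ℓ := (((b'.val : ℕ) : ZMod ℓ) - (c : ZMod ℓ)) * ((p ^ n * m : ℕ) : ZMod ℓ)⁻¹ with ht
    refine ⟨⟨t.val, ZMod.val_lt t⟩, ?_⟩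
    -- the lift agrees with `b'` mod `ℓ` and mod `m`, hence mod `mℓ`
    have hℓeq : ((c + p ^ n * m * t.val : ℕ) : ZMod ℓ) = ((b'.val : ℕ) : ZMod ℓ) := by
      push_cast
      rw [ZMod.natCast_zmod_val, show ((p : ZMod ℓ) ^ n * (m : ZMod ℓ)) = ((p ^ n * m : ℕ) : ZMod ℓ) by push_cast; ring,
        ht, mul_comm (((b'.val : ℕ) : ZMod ℓ) - (c : ZMod ℓ)) _, ← mul_assoc, ZMod.mul_inv_of_unit _ hunit, one_mul]
      ring
    have hmeq : ((c + p ^ n * m * t.val : ℕ) : ZMod m) = ((b'.val : ℕ) : ZMod m) := by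
      push_cast
      rw [ZMod.natCast_self, mul_zero, zero_mul, add_zero, hcb]
      have := hb'
      rw [ZMod.castHom_apply, ZMod.cast_eq_val] at this
      exact this.symm
    have h1 : (c + p ^ n * m * t.val) ≡ b'.val [MOD ℓ] := (ZMod.natCast_eq_natCast_iff _ _ _).mp hℓeq
    have h2 : (c + p ^ n * m * t.val) ≡ b'.val [MOD m] := (ZMod.natCast_eq_natCast_iff _ _ _).mp hmeq
    have h12 : (c + p ^ n * m * t.val) ≡ b'.val [MOD m * ℓ] :=
      (Nat.modEq_and_modEq_iff_modEq_mul hℓm.symm).mp ⟨h2, h1⟩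
    have := (ZMod.natCast_eq_natCast_iff _ _ _).mpr h12
    rw [ZMod.natCast_zmod_val] at this
    exact this
  · rintro ⟨u, rfl⟩
    rw [map_natCast]
    push_cast
    rw [ZMod.natCast_self, mul_zero, zero_mul, add_zero, hcb]

variable {N : ℕ} [NeZero N] (f : CuspForm (Gamma0 N) 2) [Fact p.Prime]

/-- **Matsuno 2000 Lemma 2.2 in the filter form of the named fact `msdMeasureTame_levelChange`**:
`∑_{b' ↦ b} μ_{f,α,mℓ}((a + pⁿℤ_p) × {b'}) = a_ℓ μ_{f,α,m}((a + pⁿℤ_p) × {b}) − μ_{f,α,m}((ℓa + pⁿℤ_p) × {ℓb})`, given the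
rationality `hrat` of the plus symbols. [cite: Matsuno2000, Lemma 2.2 (p. 85)] [cite: MazurSwinnertonDyer1974Invent, §8 Lemma 2] -/
theorem sum_filter_msdMeasureTame [NeZero m] [NeZero (m * ℓ)] (hf : IsNewform0 f)
    (hrat : ∀ r : ℚ, (ratPlusSymbol f r : ℝ) = normalizedPlusSymbol f r) (hℓ : ℓ.Prime) (hℓN : ¬ ℓ ∣ N)
    {aℓ : ℤ} (haℓ : cuspCoeff f ℓ = aℓ) (hmp : m.Coprime p) (hℓp : ℓ.Coprime p) (hℓm : ℓ.Coprime m)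
    (α : ℚ_[p]) (a : ZMod (p ^ n)) (b : ZMod m) :
    ∑ b' ∈ Finset.univ.filter (fun b' : ZMod (m * ℓ) => ZMod.castHom (dvd_mul_right m ℓ) (ZMod m) b' = b),
        msdMeasureTame f (m * ℓ) α n a b' =
      (aℓ : ℚ_[p]) * msdMeasureTame f m α n a b -
        msdMeasureTame f m α n (a * (ℓ : ZMod (p ^ n))) (b * (ℓ : ZMod m)) := by
  have hp : p.Prime := Fact.out
  rw [filter_castHom_eq_image_lift hℓ hℓp hℓm hmp a b,
    Finset.sum_image fun u _ u' _ h => lift_injective (n := n) hℓp hℓm _ h]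
  exact sum_msdMeasureTame_lift f hf hrat hℓ hℓN haℓ hmp hℓp α a b

end Fiber

/-! ## The named fact, discharged -/

section Holds

variable {N : ℕ} {p : ℕ} [Fact p.Prime]

/-- **Discharge of `msdMeasureTame_levelChange`** (Matsuno 2000 Lemma 2.2 / Mazur–Swinnerton-Dyer 1974 §8
Lemma 2, two-term form over all `ℓ` classes): for a rational normalised newform `f` of level `N`, a prime
`ℓ ∤ N` coprime to `pm`, `(m, p) = 1`, `a_ℓ(f) = a_ℓ`, every `α`, `n`, `a mod pⁿ`, `b mod m`:
`∑_{b' ↦ b} μ_{f,α,mℓ}((a + pⁿℤ_p) × {b'}) = a_ℓ μ_{f,α,m}((a + pⁿℤ_p) × {b}) − μ_{f,α,m}((ℓa + pⁿℤ_p) × {ℓb})`.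
[cite: Matsuno2000, Lemma 2.2 (p. 85)] [cite: MazurSwinnertonDyer1974Invent, §8 Lemma 2] -/
theorem msdMeasureTame_levelChange_holds : msdMeasureTame_levelChange (N := N) (p := p) := by
  intro _ f hf hQ m ℓ _ _ hℓ hℓN hℓpm hmp aℓ haℓ α n a b
  exact sum_filter_msdMeasureTame f hf (ratCast_ratPlusSymbol_holds hf hQ) hℓ hℓN haℓ hmp
    (Nat.Coprime.coprime_mul_right_right hℓpm) (Nat.Coprime.coprime_mul_left_right hℓpm) α a b

end Holds

end Literature.NumberTheory.EllipticCurves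

end
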